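import Summits.ABC.IUTFork.Joshi.ATS4RowsCEFReading3
import Summits.ABC.IUTFork.Joshi.ATS4Lem671BadPrimesRamifiedGenuine
import HarnessLib

/-!
# [J-IV] (arXiv:2403.10430v2) §6.6–§6.7 / §6.11: the reading-(3) carrier of rows (6.11.1), «component sums», (6.8.11) at a tower
# whose `V^dst_ℚ` slot is READ BY THE §6.6 DEFINITION — the genuine-tower residual of rows Y-21c / Y-21e / Y-21f is EXACTLY
# «Lemma 6.7.1 (4) ⟹ (2) at the bad primes» ∧ «2·3·5·ℓ ramifies in L′»

Proof-only rider (0 defs) of the abc-iut cell, R-J «Joshi Y-discharge census» rows **Y-21c / Y-21e / Y-21f** (rung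
LADDER-ABC:A2.RESCUE.J), seat abc-iut-E-t24 (gen 9; authors-first rider on the seat's own `Joshi/ATS4RowsCEFReading3.lean`,
p460339 / p460545, which stays byte-identical — DEFS-FREEZE). It makes kernel the INFO I1 recorded in both of the seat's counted
double-reads (p453374, p456387). SOURCE: K. Joshi, *Construction of Arithmetic Teichmüller Spaces IV*, arXiv:2403.10430v2
(unrefereed; bib `Joshi2024ATS4`): §6.6 p.60 l.56–62 («v ∈ V^dst_M, if and only if, v extends to a prime of L′ which is ramified
over ℚ»), Lemma 6.7.1 p.61 l.20–30 («(1) v_ℚ ∈ V^dst_ℚ (2) v_ℚ ramifies in L′ (3) v_ℚ divides 30·ℓ or v_ℚ is in the image of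
Supp(q_{L_tpd} + d_{L_tpd}) (4) …»). Page/line = the cell's render `HOME/lit/renders/Joshi-arxiv-2403.10430/`.

WHAT p460339 PROVED. Rows c/e/f of the E5 spine hold JOINTLY on one carrier `dd : LocusVolumeDatum` under the spine's three glues
whenever `dd`'s `V^dst_ℚ` slot IS the reading-(3) set `R₃ := primeFactors(30ℓ) ∪ p(Supp 𝔮_{F_tpd}) ∪ primeFactors(disc F_tpd)` —
with NO use of Lemma 6.7.1 (3) ⟹ (2). One of the three glues, E-t31's `TowerGlue T dd`, identifies `dd.Vdst` with the §6.7 object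
`T.vdstQFinset` of a tower `T : PrimeTowerDatum`, i.e. with the image in `V_ℚ` of the slot `T.Ramified` («the primes of L′
ramified over ℚ»). `PrimeTowerDatum` is a SIGNATURE: `Ramified` is free data, so the antecedent «`TowerGlue T dd ∧ dd.Vdst = R₃`» is
inhabited by a tower whose `Ramified` slot is chosen to fit (§4: for every finite set of primes `R` there is a tower with
`V^dst_ℚ = R`). THIS FILE asks what the same antecedent says when `T` reads `V^dst_ℚ` GENUINELY — by the §6.6 definition at the top
field `L′ = K` of the theta-division tower: hypothesis `hT : ∀ p, p ∈ T.VdstQ ↔ ∃ u ∈ 𝔓(K), p_u = p ∧ e(u|p) ≥ 2` (the other slots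
of `T` stay free; no genuine `PrimeTowerDatum` constructor is posited).

RESULT (§3). Under `hT`, `TowerGlue T dd` gives `dd.Vdst = primeFactors(disc K)` (Dedekind: «p ramifies in K ⟺ p ∣ disc K»,
tree `exists_two_le_ramificationIdx_of_dvd_discr` / `GenuineVdst.residueChar_mem_primeFactors_discr`), and then
(`TowerGlue.vdst_eq_reading3_iff_of_genuine`)
  `dd.Vdst = R₃ ⟺ R₃ ⊆ primeFactors(disc K)` — the inclusion `⊇` being Lemma 6.7.1 (2) ⟹ (3), PROVED on the theta-division tower by
  abc-iut-E-t35 (`GenuineVdst.primeFactors_discr_subset`, p456387, consumed BY NAME) —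
  `⟺ (i) «every prime dividing 2·3·5·ℓ divides disc K» ∧ (ii) «every bad place of λ away from {2, ℓ} lies under a place of K
  ramified over ℚ»`,
the third clause of `R₃` («p ∣ disc F_tpd») being free (`disc F_tpd ∣ disc K`, E-t35's `GenuineVdst.primeFactors_discr_mono`).
Clause (ii) is VERBATIM the hypothesis `h412` («Lemma 6.7.1 (4) ⟹ (2)») of E-t35's `componentSums_of_genuine_defn` at `L := F_tpd`,
`𝔮 := 𝔮_{F_tpd}`; E-t35's sequel p462498/p462897 (`ATS4Lem671BadPrimesRamifiedGenuine`, Tate-curve ramification) DERIVES it on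
`K = F(E_F[ℓ])`, `ℓ ≥ 7`, MODULO the located rider (P2) «ℓ ∤ ord_v(j(λ))» (`Cor22.CondP2`; Joshi's Lemma 5.8.7 (2) for his own
`ℓ`, not a standing hypothesis of Thm 6.1.1) — consumed BY NAME in `TowerGlue.vdst_eq_reading3_iff_thirtyL_of_condP2`: modulo (P2)
the reading-(3) equation at a genuine tower is EQUIVALENT to clause (i) ALONE. Clause (i) is print's «L′ ⊇ ℚ(μ_{4·3·5·ℓ})» (√−1 ∈
F, E_F[3·5] ⊆ E(F), E_F[ℓ] ⊆ E(K) and the Weil pairing — the tree types `galoisRepTorsion` without a Weil pairing, so (i) is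
NAMED here, not derived; the cyclotomic ramification itself is in tree, `ramificationIdx_eq_of_cyclotomic_prime`). E-t35's v2 §5
(`primeFactors_discr_sdiff_eq_reading3_sdiff`) already records «(1) ⟺ (3) away from 30ℓ» modulo (P2); what is added here is the
transport through E-t31's `TowerGlue` to p460339's hypothesis, the isolation of (i) as the ONE remaining clause, the rows-c/e/f
corollaries (`rows_cef_thetaTower_genuine`, `…_of_condP2`), and (§4) the SIGNATURE-LEVEL fact: for every finite set of primes
`R` there is a tower with `V^dst_ℚ = R`, so with `T`'s `Ramified` slot free the reading-(3) antecedent of p460339/p460545 is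
inhabited outright. Numbers, not adjectives: at a tower reading `V^dst_ℚ` GENUINELY (`K = F(E_F[ℓ])`, `ℓ ≥ 7`, (P2)) rows
c/e/f close iff the primes of `30ℓ` divide `disc K` — nothing else of Lemma 6.7.1 enters.

FRAMING (binding): classical algebraic number theory + finite bookkeeping composed with the cell's PROVED statements. NO side is
taken on [IUTchIII] Cor. 3.12 / [IUTchIV] Thm. 1.10, on Joshi's claims or on Mochizuki's report on them; NOT a test verdict; NOT
an abc claim. Typed ≠ proved ≠ endorsed. Theorems only; standard axioms; no `sorry`, instance, notation, `def` or new `Prop`.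
FACT rows: none. [claim: Joshi2024ATS4, status: disputed].
-/

noncomputable section

open Finset NumberField IsDedekindDomain
open Literature.IUT.LogVolume Literature.IUT.LogVolume.Cor22
open Literature.NumberTheory.DiophantineGeometry Literature.NumberTheory.DiophantineGeometry.GenEll
open Literature.NumberTheory.EllipticCurves

namespace Summit.ABC.IUTFork.Joshi.ATS4

/-! ## 1. «p ramifies in K» as a finite set: `primeFactors(disc K)` (Dedekind) -/

namespace GenuineVdst

/-- **Dedekind's discriminant theorem in `Finset` form**: a rational prime `p` divides `disc K` iff some place of `K` over `p` is
ramified over `ℚ`. Tree: `exists_two_le_ramificationIdx_of_dvd_discr` (⟹) and E-t35's `residueChar_mem_primeFactors_discr` (⟸).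
[cite: NeukirchANT1999, Ch. III (2.12)] -/
theorem mem_primeFactors_discr_iff (K : Type*) [Field K] [NumberField K] (p : ℕ) :
    p ∈ (discr K).natAbs.primeFactors ↔
      ∃ u : HeightOneSpectrum (𝓞 K), residueChar K u = p ∧ 2 ≤ u.asIdeal.ramificationIdx ℤ := by
  refine ⟨fun hp => exists_two_le_ramificationIdx_of_dvd_discr K (Nat.prime_of_mem_primeFactors hp)
    (Int.natCast_dvd.mpr (Nat.dvd_of_mem_primeFactors hp)), ?_⟩
  rintro ⟨u, rfl, hu⟩
  exact residueChar_mem_primeFactors_discr u hu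

/-- **«Lemma 6.7.1 (4) ⟹ (2)» in the two currencies**: E-t35's hypothesis `h412` («every place of `Supp(𝔮_L)` lies under a place of
`K` ramified over `ℚ`», `componentSums_of_genuine_defn`) iff «the residue characteristic of every place of `Supp(𝔮_L)` divides
`disc K`». [claim: Joshi2024ATS4, status: disputed] -/
theorem h412_iff_residueChar_mem_primeFactors_discr (K : Type*) [Field K] [NumberField K] {L : Type*} [Field L] [NumberField L]
    (𝔮 : TateDivisorDatum L) :
    (∀ w ∈ 𝔮.V, ∃ u : HeightOneSpectrum (𝓞 K), residueChar K u = residueChar L w ∧ 2 ≤ u.asIdeal.ramificationIdx ℤ) ↔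
      ∀ w ∈ 𝔮.V, residueChar L w ∈ (discr K).natAbs.primeFactors :=
  forall₂_congr fun w _ => (mem_primeFactors_discr_iff K (residueChar L w)).symm

/-! ## 2. The reading-(3) set versus `primeFactors(disc K)`: the third clause is free -/

/-- **`R₃ ⊆ primeFactors(disc K)` splits into its `30ℓ`-clause and its bad-prime clause** — the `disc F_tpd`-clause of the
reading-(3) set holds for every `K ⊇ F_tpd` (`disc F_tpd ∣ disc K`, E-t35's `GenuineVdst.primeFactors_discr_mono` / Mathlib
`NumberField.discr_dvd_discr`). PROVED. [claim: Joshi2024ATS4, status: disputed] -/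
theorem reading3_subset_primeFactors_discr_iff (P : NFPoint) (ℓ : ℕ) (K : Type*) [Field K] [NumberField K] [Algebra P.F K] :
    (2 * 3 * 5 * ℓ).primeFactors ∪ (TateDivisorDatum.ofNFPoint P {2, ℓ}).V.image (residueChar P.F) ∪
        (discr P.F).natAbs.primeFactors ⊆ (discr K).natAbs.primeFactors ↔
      (∀ p ∈ (2 * 3 * 5 * ℓ).primeFactors, p ∈ (discr K).natAbs.primeFactors) ∧
        ∀ v ∈ (TateDivisorDatum.ofNFPoint P {2, ℓ}).V, residueChar P.F v ∈ (discr K).natAbs.primeFactors := by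
  refine ⟨fun h => ⟨fun p hp => h (mem_union_left _ (mem_union_left _ hp)),
    fun v hv => h (mem_union_left _ (mem_union_right _ (mem_image_of_mem _ hv)))⟩, ?_⟩
  rintro ⟨h₁, h₂⟩ p hp
  rcases mem_union.mp hp with hp | hp
  · rcases mem_union.mp hp with hp | hp
    · exact h₁ p hp
    · obtain ⟨v, hv, rfl⟩ := mem_image.mp hp
      exact h₂ v hv
  · exact primeFactors_discr_mono P.F K hp

/-- The `30ℓ`-clause in the «ramifies» currency: «every prime dividing `2·3·5·ℓ` lies under a place of `K` ramified over `ℚ`»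
(print: `L′ ⊇ ℚ(μ_{4·3·5·ℓ})`; NAMED, not derived — see the module docstring). [claim: Joshi2024ATS4, status: disputed] -/
theorem thirtyL_clause_iff {ℓ : ℕ} (hℓ : ℓ ≠ 0) (K : Type*) [Field K] [NumberField K] :
    (∀ p ∈ (2 * 3 * 5 * ℓ).primeFactors, p ∈ (discr K).natAbs.primeFactors) ↔
      ∀ p : ℕ, p.Prime → p ∣ 2 * 3 * 5 * ℓ →
        ∃ u : HeightOneSpectrum (𝓞 K), residueChar K u = p ∧ 2 ≤ u.asIdeal.ramificationIdx ℤ := by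
  refine ⟨fun h p hp hdvd => (mem_primeFactors_discr_iff K p).1 (h p (Nat.mem_primeFactors.mpr ⟨hp, hdvd, by positivity⟩)),
    fun h p hp => ?_⟩
  have hp' := Nat.mem_primeFactors.mp hp
  exact (mem_primeFactors_discr_iff K p).2 (h p hp'.1 hp'.2.1)

end GenuineVdst

/-! ## 3. Under `TowerGlue` with `V^dst_ℚ` READ BY THE §6.6 DEFINITION at `L′ = K` -/

namespace PrimeTowerDatum

/-- **A tower reading `V^dst_ℚ` by the §6.6 DEFINITION at `L′ = K` has `V^dst_ℚ = primeFactors(disc K)`** as finite sets. `hT` is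
the hypothesis «`p ∈ V^dst_ℚ` iff some place of `K` over `p` is ramified over `ℚ`» (p.60 l.58–62 with p.61 l.14–19; Lemma 6.7.1
(1) ⟺ (2) is then `T.lem671_one_iff_two`, definitional). PROVED. [claim: Joshi2024ATS4, status: disputed] -/
theorem vdstQFinset_eq_primeFactors_discr (T : PrimeTowerDatum) (K : Type*) [Field K] [NumberField K]
    (hT : ∀ p, p ∈ T.VdstQ ↔ ∃ u : HeightOneSpectrum (𝓞 K), residueChar K u = p ∧ 2 ≤ u.asIdeal.ramificationIdx ℤ) :
    T.vdstQFinset = (discr K).natAbs.primeFactors := by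
  ext p
  rw [T.mem_vdstQFinset, hT, GenuineVdst.mem_primeFactors_discr_iff]

namespace TowerGlue

variable {T : PrimeTowerDatum} {dd : LocusVolumeDatum} (GT : TowerGlue T dd)
include GT

/-- Under E-t31's `TowerGlue`, the carrier's `V^dst_ℚ` slot IS the tower's: `dd.Vdst = R ⟺ T.vdstQFinset = R` (so p460339's
`hVdst` is a constraint on the TOWER, free at signature level — §4 — and equal to Lemma 6.7.1 (2) ⟺ (3) at a genuine one — below).
[claim: Joshi2024ATS4, status: disputed] -/
theorem vdst_eq_iff (R : Finset ℕ) : dd.Vdst = R ↔ T.vdstQFinset = R := by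
  rw [GT.vdst_eq]

/-- Under `TowerGlue` to a tower reading `V^dst_ℚ` GENUINELY at `L′ = K`: `dd.Vdst = primeFactors(disc K)` — E-t35's §6.6-definition
reading `hVdst` of `componentSums_of_genuine_defn` is then automatic. PROVED. [claim: Joshi2024ATS4, status: disputed] -/
theorem vdst_eq_primeFactors_discr (K : Type*) [Field K] [NumberField K]
    (hT : ∀ p, p ∈ T.VdstQ ↔ ∃ u : HeightOneSpectrum (𝓞 K), residueChar K u = p ∧ 2 ≤ u.asIdeal.ramificationIdx ℤ) :
    dd.Vdst = (discr K).natAbs.primeFactors := by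
  rw [GT.vdst_eq, T.vdstQFinset_eq_primeFactors_discr K hT]

end TowerGlue

end PrimeTowerDatum

section ThetaTower

variable {P : NFPoint} {F : Type} [Field F] [NumberField F] [Algebra P.F F]
  {K : Type} [Field K] [NumberField K] [Algebra F K] [Algebra P.F K] [IsScalarTower P.F F K]
  (ψ : K →ₐ[F] AlgebraicClosure F) {ℓ : ℕ}

/-- **On the theta-division tower, `R₃ = primeFactors(disc K) ⟺ R₃ ⊆ primeFactors(disc K)`**: the inclusion `⊇` is Lemma 6.7.1
(2) ⟹ (3), PROVED by E-t35 (`GenuineVdst.primeFactors_discr_subset` with `hsupp_ofNFPoint_pair`, p456387 — BY NAME). Data: `λ ∈ U`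
(`hU`), `F` a theta field of `λ`, `K ⊇ F` Galois inside `F(E_F[ℓ])`, `ℓ` prime. [claim: Joshi2024ATS4, status: disputed] -/
theorem GenuineVdst.primeFactors_discr_eq_reading3_iff (hU : P.InU) (hF : IsThetaField P F) [IsGalois F K] (hℓ : ℓ.Prime)
    (hK : letI := thetaCurve_isElliptic hU F
      ((thetaCurve P F).galoisRepTorsion (ℓ : ℤ)).ker ≤ ψ.fieldRange.fixingSubgroup) :
    (discr K).natAbs.primeFactors = (2 * 3 * 5 * ℓ).primeFactors ∪
        (TateDivisorDatum.ofNFPoint P {2, ℓ}).V.image (residueChar P.F) ∪ (discr P.F).natAbs.primeFactors ↔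
      (2 * 3 * 5 * ℓ).primeFactors ∪ (TateDivisorDatum.ofNFPoint P {2, ℓ}).V.image (residueChar P.F) ∪
        (discr P.F).natAbs.primeFactors ⊆ (discr K).natAbs.primeFactors :=
  ⟨fun h => h ▸ Finset.Subset.refl _, fun h =>
    Finset.Subset.antisymm (GenuineVdst.primeFactors_discr_subset ψ hU hF hℓ hK (GenuineVdst.hsupp_ofNFPoint_pair hℓ)) h⟩

/-- **MAIN — the genuine-tower residual of rows Y-21c/e/f.** For `λ ∈ U`, `F` a theta field, `K ⊇ F` Galois inside `F(E_F[ℓ])`,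
`ℓ` prime, a carrier `dd` under E-t31's `TowerGlue T dd` to a tower `T` whose `V^dst_ℚ` is READ BY THE §6.6 DEFINITION at `L′ = K`
(`hT`): p460339's reading-(3) hypothesis `dd.Vdst = primeFactors(30ℓ) ∪ p(Supp 𝔮_{F_tpd}) ∪ primeFactors(disc F_tpd)` HOLDS IFF
(i) «every prime dividing `2·3·5·ℓ` divides `disc K`» AND (ii) «every bad place of `λ` away from `{2, ℓ}` lies under a place of `K`
ramified over `ℚ`» — (ii) is VERBATIM E-t35's `h412` (Lemma 6.7.1 (4) ⟹ (2)) at `L := F_tpd`, `𝔮 := 𝔮_{F_tpd} = ofNFPoint λ {2,ℓ}`;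
the `disc F_tpd`-clause is discharged, the converse inclusion is E-t35's (2) ⟹ (3). PROVED (a biconditional; neither clause is
asserted). [claim: Joshi2024ATS4, status: disputed] -/
theorem PrimeTowerDatum.TowerGlue.vdst_eq_reading3_iff_of_genuine (hU : P.InU) (hF : IsThetaField P F) [IsGalois F K]
    (hℓ : ℓ.Prime)
    (hK : letI := thetaCurve_isElliptic hU F
      ((thetaCurve P F).galoisRepTorsion (ℓ : ℤ)).ker ≤ ψ.fieldRange.fixingSubgroup)
    {T : PrimeTowerDatum} {dd : LocusVolumeDatum} (GT : PrimeTowerDatum.TowerGlue T dd)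
    (hT : ∀ p, p ∈ T.VdstQ ↔ ∃ u : HeightOneSpectrum (𝓞 K), residueChar K u = p ∧ 2 ≤ u.asIdeal.ramificationIdx ℤ) :
    dd.Vdst = (2 * 3 * 5 * ℓ).primeFactors ∪ (TateDivisorDatum.ofNFPoint P {2, ℓ}).V.image (residueChar P.F) ∪
        (discr P.F).natAbs.primeFactors ↔
      (∀ p ∈ (2 * 3 * 5 * ℓ).primeFactors, p ∈ (discr K).natAbs.primeFactors) ∧
        ∀ v ∈ (TateDivisorDatum.ofNFPoint P {2, ℓ}).V,
          ∃ u : HeightOneSpectrum (𝓞 K), residueChar K u = residueChar P.F v ∧ 2 ≤ u.asIdeal.ramificationIdx ℤ := by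
  rw [GT.vdst_eq_primeFactors_discr K hT, GenuineVdst.primeFactors_discr_eq_reading3_iff ψ hU hF hℓ hK,
    GenuineVdst.reading3_subset_primeFactors_discr_iff, GenuineVdst.h412_iff_residueChar_mem_primeFactors_discr]

/-- **Corollary — rows c, e, f at a tower reading `V^dst_ℚ` GENUINELY.** Same data plus the rest of p460339's
`rows_cef_thetaTower_reading3` hypotheses (the `MainBoundGlue` at the genuine datum, the `DescentGlue`, the genuine component
readings); the reading-(3) equation `hVdst` is REPLACED by its genuine-tower content (i) ∧ (ii). Then `dd.Eq6111 ∧ dd.ComponentSums ∧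
dd.Eq6811`. PROVED AS AN IMPLICATION; (i) and (ii) are hypotheses, not discharged. [claim: Joshi2024ATS4, status: disputed] -/
theorem LocusVolumeDatum.rows_cef_thetaTower_genuine (hP : P ∈ UP) (hF : IsThetaField P F) [IsGalois F K] (hℓ : ℓ.Prime)
    (hK : letI := thetaCurve_isElliptic hP.1 F
      ((thetaCurve P F).galoisRepTorsion (ℓ : ℤ)).ker ≤ ψ.fieldRange.fixingSubgroup)
    (Lmod : Type*) [Field Lmod] [NumberField Lmod] (h5 : 5 ≤ ℓ)
    (hq : 0 < (TateDivisorDatum.ofNFPointOver P {2, ℓ} F).logq)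
    {dd : LocusVolumeDatum}
    (G : MainBoundGlue (MainBoundDatum.ofGenuine Lmod hℓ h5 (TateDivisorDatum.ofNFPoint P {2, ℓ})
      (TateDivisorDatum.ofNFPointOver P {2, ℓ} F) (TateDivisorDatum.ofNFPointOver P {2, ℓ} K) hq) dd)
    (hmod : Cor22.dmod P ≤ dMod Lmod)
    {lstar : ℕ} {W : Type} [Fintype W] {D : SecondMainBoundDatum lstar W} (GD : DescentGlue D dd)
    {T : PrimeTowerDatum} (GT : PrimeTowerDatum.TowerGlue T dd)
    (hT : ∀ p, p ∈ T.VdstQ ↔ ∃ u : HeightOneSpectrum (𝓞 K), residueChar K u = p ∧ 2 ≤ u.asIdeal.ramificationIdx ℤ)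
    (h30 : ∀ p ∈ (2 * 3 * 5 * ℓ).primeFactors, p ∈ (discr K).natAbs.primeFactors)
    (h412 : ∀ v ∈ (TateDivisorDatum.ofNFPoint P {2, ℓ}).V,
      ∃ u : HeightOneSpectrum (𝓞 K), residueChar K u = residueChar P.F v ∧ 2 ≤ u.asIdeal.ramificationIdx ℤ)
    (ι : W → HeightOneSpectrum (𝓞 F)) (hι : ∀ w, ι w ∈ (TateDivisorDatum.ofNFPointOver P {2, ℓ} F).V)
    (hAt : ∀ p ∈ dd.Vdst, dd.logVolAt p = ∑ w ∈ Finset.univ with residueChar F (ι w) = p, |Real.log (D.std.loc w).hullVol|)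
    (hArch : dd.logVolArch = 0)
    (DK : Finset (HeightOneSpectrum (𝓞 K))) (hDK : ∀ u, differentDivisor K (Sum.inr u) ≠ 0 → u ∈ DK)
    (hDiffAt : ∀ p ∈ dd.Vdst, dd.logDiffLpAt p =
      (Module.finrank ℚ K : ℝ)⁻¹ * ∑ u ∈ DK with residueChar K u = p, differentDivisor K (Sum.inr u) * logNorm K u)
    (hqAt : ∀ p ∈ dd.Vdst, dd.logqAt p =
      (Module.finrank ℚ F : ℝ)⁻¹ * ∑ w ∈ (TateDivisorDatum.ofNFPointOver P {2, ℓ} F).V with residueChar F w = p,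
        (TateDivisorDatum.ofNFPointOver P {2, ℓ} F).tateDivisor (Sum.inr w) * logNorm F w) :
    dd.Eq6111 ∧ dd.ComponentSums ∧ dd.Eq6811 :=
  LocusVolumeDatum.rows_cef_thetaTower_reading3 ψ Lmod h5 hq hP hF hℓ hK G hmod GD GT
    ((PrimeTowerDatum.TowerGlue.vdst_eq_reading3_iff_of_genuine ψ hP.1 hF hℓ hK GT hT).2 ⟨h30, h412⟩)
    ι hι hAt hArch DK hDK hDiffAt hqAt

/-- **MAIN modulo the located rider (P2)** — clause (ii) DISCHARGED by abc-iut-E-t35's Lemma 6.7.1 (4) ⟹ (2) on the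
`ℓ`-division tower (`GenuineVdst.image_residueChar_ofNFPoint_subset_primeFactors_discr`, p462498/p462897, BY NAME): for `λ ∈ U`,
`F` a theta field, `K` Galois over `F` with `K ⊆ F(E_F[ℓ])` (`hK`) and `K ⊇ F(E_F[ℓ])` (`hKℓ`) — Joshi's `L′` —, `ℓ ≥ 7` prime with
(P2) «`ℓ ∤ ord_v(j(λ))` at every pole» (`Cor22.CondP2`, = Joshi's Lemma 5.8.7 (2) for his own `ℓ`), and a carrier under
`TowerGlue` to a tower reading `V^dst_ℚ` GENUINELY at `K`: p460339's reading-(3) equation holds IFF «every prime dividing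
`2·3·5·ℓ` divides `disc K`» — print's «`L′ ⊇ ℚ(μ_{4·3·5·ℓ})`», the ONE clause of Lemma 6.7.1 the tree does not derive (no Weil
pairing for `galoisRepTorsion`). PROVED (a biconditional). [claim: Joshi2024ATS4, status: disputed] -/
theorem PrimeTowerDatum.TowerGlue.vdst_eq_reading3_iff_thirtyL_of_condP2 (hU : P.InU) (hF : IsThetaField P F) [IsGalois F K]
    (hℓ : ℓ.Prime) (h7 : 7 ≤ ℓ) (hP2 : CondP2 P ℓ)
    (hK : letI := thetaCurve_isElliptic hU F
      ((thetaCurve P F).galoisRepTorsion (ℓ : ℤ)).ker ≤ ψ.fieldRange.fixingSubgroup)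
    (hKℓ : ∀ (σ : Field.absoluteGaloisGroup K) (Q : WeierstrassCurve.geomTorsion (thetaCurve P K) (ℓ : ℤ)), σ • Q = Q)
    {T : PrimeTowerDatum} {dd : LocusVolumeDatum} (GT : PrimeTowerDatum.TowerGlue T dd)
    (hT : ∀ p, p ∈ T.VdstQ ↔ ∃ u : HeightOneSpectrum (𝓞 K), residueChar K u = p ∧ 2 ≤ u.asIdeal.ramificationIdx ℤ) :
    dd.Vdst = (2 * 3 * 5 * ℓ).primeFactors ∪ (TateDivisorDatum.ofNFPoint P {2, ℓ}).V.image (residueChar P.F) ∪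
        (discr P.F).natAbs.primeFactors ↔
      ∀ p ∈ (2 * 3 * 5 * ℓ).primeFactors, p ∈ (discr K).natAbs.primeFactors := by
  rw [GT.vdst_eq_reading3_iff_of_genuine ψ hU hF hℓ hK hT]
  refine ⟨fun h => h.1, fun h => ⟨h, ?_⟩⟩
  exact (GenuineVdst.h412_iff_residueChar_mem_primeFactors_discr K (TateDivisorDatum.ofNFPoint P {2, ℓ})).2
    fun v hv => GenuineVdst.image_residueChar_ofNFPoint_subset_primeFactors_discr hU hF hℓ h7 hP2 hKℓ
      (S := {2, ℓ}) (by simp) (Finset.mem_image_of_mem _ hv)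

/-- **Corollary — rows c, e, f at a tower reading `V^dst_ℚ` GENUINELY, modulo (P2), with ONE named clause.** Same data as
`rows_cef_thetaTower_genuine` with `K = F(E_F[ℓ])` (`hK`, `hKℓ`), `ℓ ≥ 7`, (P2); the reading-(3) equation of p460339 is replaced
by its genuine-tower content «`2·3·5·ℓ`'s primes divide `disc K`» (`h30`, NAMED, not derived). Then `dd.Eq6111 ∧ dd.ComponentSums ∧
dd.Eq6811`. PROVED AS AN IMPLICATION. [claim: Joshi2024ATS4, status: disputed] -/
theorem LocusVolumeDatum.rows_cef_thetaTower_genuine_of_condP2 (hP : P ∈ UP) (hF : IsThetaField P F) [IsGalois F K]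
    (hℓ : ℓ.Prime) (h7 : 7 ≤ ℓ) (hP2 : CondP2 P ℓ)
    (hK : letI := thetaCurve_isElliptic hP.1 F
      ((thetaCurve P F).galoisRepTorsion (ℓ : ℤ)).ker ≤ ψ.fieldRange.fixingSubgroup)
    (hKℓ : ∀ (σ : Field.absoluteGaloisGroup K) (Q : WeierstrassCurve.geomTorsion (thetaCurve P K) (ℓ : ℤ)), σ • Q = Q)
    (Lmod : Type*) [Field Lmod] [NumberField Lmod] (h5 : 5 ≤ ℓ)
    (hq : 0 < (TateDivisorDatum.ofNFPointOver P {2, ℓ} F).logq)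
    {dd : LocusVolumeDatum}
    (G : MainBoundGlue (MainBoundDatum.ofGenuine Lmod hℓ h5 (TateDivisorDatum.ofNFPoint P {2, ℓ})
      (TateDivisorDatum.ofNFPointOver P {2, ℓ} F) (TateDivisorDatum.ofNFPointOver P {2, ℓ} K) hq) dd)
    (hmod : Cor22.dmod P ≤ dMod Lmod)
    {lstar : ℕ} {W : Type} [Fintype W] {D : SecondMainBoundDatum lstar W} (GD : DescentGlue D dd)
    {T : PrimeTowerDatum} (GT : PrimeTowerDatum.TowerGlue T dd)
    (hT : ∀ p, p ∈ T.VdstQ ↔ ∃ u : HeightOneSpectrum (𝓞 K), residueChar K u = p ∧ 2 ≤ u.asIdeal.ramificationIdx ℤ)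
    (h30 : ∀ p ∈ (2 * 3 * 5 * ℓ).primeFactors, p ∈ (discr K).natAbs.primeFactors)
    (ι : W → HeightOneSpectrum (𝓞 F)) (hι : ∀ w, ι w ∈ (TateDivisorDatum.ofNFPointOver P {2, ℓ} F).V)
    (hAt : ∀ p ∈ dd.Vdst, dd.logVolAt p = ∑ w ∈ Finset.univ with residueChar F (ι w) = p, |Real.log (D.std.loc w).hullVol|)
    (hArch : dd.logVolArch = 0)
    (DK : Finset (HeightOneSpectrum (𝓞 K))) (hDK : ∀ u, differentDivisor K (Sum.inr u) ≠ 0 → u ∈ DK)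
    (hDiffAt : ∀ p ∈ dd.Vdst, dd.logDiffLpAt p =
      (Module.finrank ℚ K : ℝ)⁻¹ * ∑ u ∈ DK with residueChar K u = p, differentDivisor K (Sum.inr u) * logNorm K u)
    (hqAt : ∀ p ∈ dd.Vdst, dd.logqAt p =
      (Module.finrank ℚ F : ℝ)⁻¹ * ∑ w ∈ (TateDivisorDatum.ofNFPointOver P {2, ℓ} F).V with residueChar F w = p,
        (TateDivisorDatum.ofNFPointOver P {2, ℓ} F).tateDivisor (Sum.inr w) * logNorm F w) :
    dd.Eq6111 ∧ dd.ComponentSums ∧ dd.Eq6811 :=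
  LocusVolumeDatum.rows_cef_thetaTower_reading3 ψ Lmod h5 hq hP hF hℓ hK G hmod GD GT
    ((PrimeTowerDatum.TowerGlue.vdst_eq_reading3_iff_thirtyL_of_condP2 ψ hP.1 hF hℓ h7 hP2 hK hKℓ GT hT).2 h30)
    ι hι hAt hArch DK hDK hDiffAt hqAt

end ThetaTower

/-! ## 4. At SIGNATURE level the reading-(3) antecedent is inhabited outright -/

namespace PrimeTowerDatum

/-- **For every finite set `R` of primes and every `ℓ` there is a tower (of the SIGNATURE `PrimeTowerDatum`) with `V^dst_ℚ = R` and
prime `ℓ`-slot `ℓ`**: E-t31's rational-primes model `primesTower` (p455807's sibling, `ATS4RamificationDivisorsPrimes`) with its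
`Ramified` slot RE-CHOSEN as the primes in `R`. A model of the signature — nothing of the arithmetic of any curve; it shows that
p460339's `hVdst` constrains nothing unless `T` reads `V^dst_ℚ` genuinely (§3). [folklore] -/
theorem exists_vdstQFinset_eq (R : Finset ℕ) (hR : ∀ p ∈ R, p.Prime) (ℓ : ℕ) :
    ∃ T : PrimeTowerDatum, T.vdstQFinset = R ∧ T.l = ℓ ∧ ∀ v : T.Pmod, (T.char v).Prime := by
  classical
  refine ⟨{ primesTower with
    Ramified := Subtype.val ⁻¹' (R : Set ℕ)
    ramified_finite := (R.finite_toSet).preimage Subtype.val_injective.injOn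
    l := ℓ }, ?_, rfl, fun v => v.2⟩
  ext p
  rw [mem_vdstQFinset, vdstQ_eq]
  change p ∈ Subtype.val '' (Subtype.val ⁻¹' (R : Set ℕ)) ↔ p ∈ R
  refine ⟨?_, fun hp => ⟨⟨p, hR p hp⟩, by simpa using hp, rfl⟩⟩
  rintro ⟨q, hq, rfl⟩
  exact hq

end PrimeTowerDatum

end Summit.ABC.IUTFork.Joshi.ATS4

end
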